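/-
Copyright (c) 2026 the pub-hodgecm-mathlib formalisation cell (harness21).  Prover seat hodgecm-mathlib-K2E1-p08 (g6), Track B ∕ K2-LIT
(build stream 29), h413 = `stmt-HodgeConjecture-24833`, line `K2_E1_TraceFormulaBeta`, campaign «EIS-R7-BL-SPH-2» (Bernstein–Lapid soft continuation of
the spherical Borel Eisenstein series of `U(1,1)`), file «P2a-ι» part 3 (the wrappers on ★ leaf 2); dealer K2E1-plan (g5) DEAL 2026-09-04T08:55:26Z (1) + 09:02:12Z (ii).
-/
import Summits.HodgeConjecture.HodgeConjecture.Theorems.K2E1BLIotaBoundU2                   -- ★ p858831 (this seat) part 2: QMP, `‖u∘p‖ ≤ C‖u‖`, `κ‖u‖ ≤ ‖u∘p‖`, `w₁` Borel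
import Summits.HodgeConjecture.HodgeConjecture.Theorems.K2E1BLBorelOperatorsU2Defs           -- ★ p858786 (K2E4-p10 g5) leaf 2: `IotaBound`, `iota`, `piN`
import HarnessLib

/-!
# h413 ∕ Track B «K2-LIT», campaign «EIS-R7-BL-SPH-2» — helper `K2E1BLIotaClosedEmbeddingU2` («P2a-ι», part 3, `N = 2`, CM pair): `ι_{c,k} : 𝓗_k(𝔛) → 𝓗_k(Z_c)` IS A CLOSED
# EMBEDDING — the letters `IotaBound`, `Injective ι`, `IsClosed (range ι)` of ★ leaf 2's `iota` ∕ `piN` are THEOREMS, and `𝓗_k(Z_c)` has FINITE total mass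

Cell `pub/hodgecm-mathlib`, crux H413 = `stmt-HodgeConjecture-24833`, route of record `HCCMUnconditional`; chair K2-lead (g1), dealer K2E1-plan (g5) (DEAL «P2a-ι» 08:55:26Z; 09:02:12Z (ii)
«add `isFiniteMeasure_weightedTruncMeasure_cm` — K2E4-p23's K2 consumes it by name»); spec of record = K2E1b-plan (g6) WIRING «EIS-R7-BL-SPH-2» `7d1cceb628a30de8` §3 P2a [BernsteinLapid2019, §4
Claim 4 bullet 1 (arXiv:1911.02342 p. 10)].  THEOREMS ONLY (no `def`, no `instance`, no `notation`, no named-fact hypothesis, no `sorry`); lane `--kind proof --supports stmt-HodgeConjecture-24833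
--as helper` (count-neutral).  Letters of record (dealer RULING D2 08:59:22Z, K2E4-p10 «=» 09:03:46Z): `(μ) [IsAutomorphicMeasure μ] (νG) [IsHaarMeasure] [IsInvInvariant] (hβ : IsCoveringWeight B(F)♯ β)
(hμZ : ∀ f, Measurable f → ∫⁻ f ∂μZ = ∫⁻ β · f ∘ π ∂νG)`; datum `quasiSplit L⁺ L c 2` of the CM pair; currency of ★ leaves `K2E1BLBorelSpacesU2Defs` ∕ `K2E1BLBorelOperatorsU2Defs`.

* §1 **`iotaBound_cm (hc : 0 < c) (k) : IotaBound L⁺ L c 2 k c μ μZ`** (EVERY `c > 0`: ★ part 2 `quasiMeasurePreserving_pZX_cm` + `exists_eLpNorm_comp_pZX_le_cm`; `iotaFun f = ⇑f ∘ pZX` definitionally) — so ★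
  `iota (iotaBound_cm …)` is the honest `ι_{c,k}`; `exists_pos_forall_mul_norm_le_norm_iota_cm` (`κ‖u‖ ≤ ‖ι u‖` for `0 < c < c₁`, ★ part 2 lower bound + ★ `coeFn_iota`),
  **`antilipschitz_iota_cm`**, **`injective_iota_cm`**, **`isClosed_range_iota_cm`** (the `(hinj)(hcl)` letters of ★ `piN`, Mathlib `ContinuousLinearMap.antilipschitz_of_bound`,
  `AntilipschitzWith.isClosed_range`) — packaged as **`exists_pos_iota_closedEmbedding_cm (k) : ∃ c₁ > 0, ∀ 0 < c < c₁, Injective ι ∧ IsClosed (range ι)`**.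
* §2 **`isFiniteMeasure_weightedTruncMeasure_cm (hc : 0 < c) (k) : IsFiniteMeasure (weightedTruncMeasure L⁺ L c 2 k c μZ)`** — `wtm(Z) = ∫⁻_Z 1∘p ≤ B·∫⁻_𝔛 w₁^{−2k} dμ ≤ B·c₁^{−2k}·μ(𝔛) < ∞`
  (★ part 2 upper comparison at `F ≡ 1`, `w₁ > c₁` by the ★ covering `exists_pos_forall_lt_ciSup_borelHeight_mul_cm`, `μ` finite as an automorphic measure) — the `[IsFiniteMeasure (wtm k c₀ μZ)]`
  instance argument of ★ `K2E1TruncatedCuspCompactU2` (K2E4-p23) is thereby a theorem.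

HONEST LABEL.  Count-neutral helper of the BL-SPH-2 template (consumers: P8 closer via ★ `iota`∕`piN`, K2 ★ `K2E1TruncatedCuspCompactU2`); closes no socket; HC_CM is proved only modulo the 7
printed citations (2 remaining named inputs: hLiu418 = `stmt-HodgeConjecture-24832`, h413 = `stmt-HodgeConjecture-24833`) until rung 0 closes.

## References
* [BernsteinLapid2019] J. Bernstein, E. Lapid, *On the meromorphic continuation of Eisenstein series*, J. Amer. Math. Soc. 37 (2024) (arXiv:1911.02342), §4 Claim 4 (p. 10).
* [MoeglinWaldspurger1995] C. Mœglin, J.-L. Waldspurger, *Spectral Decomposition and Eisenstein Series* (1995), I.2.13.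
* [Borel1963] A. Borel, *Some finiteness properties of adele groups over number fields*, Publ. Math. IHÉS 16 (1963), §5.
-/

set_option autoImplicit false
-- the mandated namespace repeats `HodgeConjecture.HodgeConjecture`, as in every `Theorems/*.lean` of this sub-problem
set_option linter.dupNamespace false

noncomputable section

open MeasureTheory MeasureTheory.Measure Set NumberField IsDedekindDomain Filter Topology
open scoped NNReal ENNReal
open Literature.MeasureTheory.Group Literature.NumberTheory.Automorphic Literature.NumberTheory.Automorphic.UnitaryGroup AdelicGroupData
open Summit.HodgeConjecture.HodgeConjecture.Cruxes.H413.K2E1BLBorelSpacesU2Defs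
open Summit.HodgeConjecture.HodgeConjecture.Cruxes.H413.K2E1BLBorelOperatorsU2Defs
open Summit.HodgeConjecture.HodgeConjecture.Cruxes.H413.K2E1BLHeightCosetsU2
open Summit.HodgeConjecture.HodgeConjecture.Cruxes.H413.K2E1BLReductionCoveringU2
open Summit.HodgeConjecture.HodgeConjecture.Cruxes.H413.K2E1BLIotaUnfoldingU
open Summit.HodgeConjecture.HodgeConjecture.Cruxes.H413.K2E1BLIotaBoundU2

namespace Summit.HodgeConjecture.HodgeConjecture.Cruxes.H413.K2E1BLIotaClosedEmbeddingU2

variable (L : Type) [Field L] [NumberField L] [IsCMField L]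
  [MeasurableSpace (quasiSplit (↥(maximalRealSubfield L)) L (IsCMField.complexConj L) 2).Adelic]
  [BorelSpace (quasiSplit (↥(maximalRealSubfield L)) L (IsCMField.complexConj L) 2).Adelic]

/-! ## §1 `IotaBound` and the closed-embedding letters of `piN` are theorems -/

/-- **`IotaBound` HOLDS** (every `c > 0`): the letter of ★ leaf 2's `iota` is ⟨★ `quasiMeasurePreserving_pZX_cm`, ★ `exists_eLpNorm_comp_pZX_le_cm`⟩ (`iotaFun f = ⇑f ∘ pZX` by definition).
[cite: BernsteinLapid2019, §4 Claim 4 (p. 10)] -/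
theorem iotaBound_cm
    (μ : Measure (quasiSplit (↥(maximalRealSubfield L)) L (IsCMField.complexConj L) 2).automorphicQuotient)
    [(quasiSplit (↥(maximalRealSubfield L)) L (IsCMField.complexConj L) 2).IsAutomorphicMeasure μ]
    (νG : Measure (quasiSplit (↥(maximalRealSubfield L)) L (IsCMField.complexConj L) 2).Adelic) [νG.IsHaarMeasure] [νG.IsInvInvariant]
    {β : (quasiSplit (↥(maximalRealSubfield L)) L (IsCMField.complexConj L) 2).Adelic → ℝ≥0∞}
    (hβ : IsCoveringWeight ↥((arithmeticBorel (↥(maximalRealSubfield L)) L (IsCMField.complexConj L) 2).map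
      (quasiSplit (↥(maximalRealSubfield L)) L (IsCMField.complexConj L) 2).arithmeticSubgroup.subtype) β)
    {μZ : Measure (borelQuotient (↥(maximalRealSubfield L)) L (IsCMField.complexConj L) 2)}
    (hμZ : ∀ f : borelQuotient (↥(maximalRealSubfield L)) L (IsCMField.complexConj L) 2 → ℝ≥0∞, Measurable f →
      ∫⁻ z, f z ∂μZ = ∫⁻ g, β g * f (toBorelQuotient (↥(maximalRealSubfield L)) L (IsCMField.complexConj L) 2 g) ∂νG)
    {c₀ : ℝ≥0} (hc : 0 < c₀) (k : ℕ) :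
    IotaBound (↥(maximalRealSubfield L)) L (IsCMField.complexConj L) 2 k c₀ μ μZ :=
  ⟨quasiMeasurePreserving_pZX_cm L μ νG hβ hμZ hc k, exists_eLpNorm_comp_pZX_le_cm L μ νG hβ hμZ hc k⟩

/-- **`ι` IS BOUNDED BELOW IN NORM** (for `0 < c < c₁`, `c₁ > 0` the ★ covering constant): `∃ κ > 0, ∀ u, κ · ‖u‖ ≤ ‖ι u‖` (★ part 2 lower `L²` bound + ★ `coeFn_iota`; `Lp.norm_def`).
[cite: BernsteinLapid2019, §4 Claim 4 (p. 10)] -/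
theorem exists_pos_forall_mul_norm_le_norm_iota_cm
    (μ : Measure (quasiSplit (↥(maximalRealSubfield L)) L (IsCMField.complexConj L) 2).automorphicQuotient)
    [(quasiSplit (↥(maximalRealSubfield L)) L (IsCMField.complexConj L) 2).IsAutomorphicMeasure μ]
    (νG : Measure (quasiSplit (↥(maximalRealSubfield L)) L (IsCMField.complexConj L) 2).Adelic) [νG.IsHaarMeasure] [νG.IsInvInvariant]
    {β : (quasiSplit (↥(maximalRealSubfield L)) L (IsCMField.complexConj L) 2).Adelic → ℝ≥0∞}
    (hβ : IsCoveringWeight ↥((arithmeticBorel (↥(maximalRealSubfield L)) L (IsCMField.complexConj L) 2).map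
      (quasiSplit (↥(maximalRealSubfield L)) L (IsCMField.complexConj L) 2).arithmeticSubgroup.subtype) β)
    {μZ : Measure (borelQuotient (↥(maximalRealSubfield L)) L (IsCMField.complexConj L) 2)}
    (hμZ : ∀ f : borelQuotient (↥(maximalRealSubfield L)) L (IsCMField.complexConj L) 2 → ℝ≥0∞, Measurable f →
      ∫⁻ z, f z ∂μZ = ∫⁻ g, β g * f (toBorelQuotient (↥(maximalRealSubfield L)) L (IsCMField.complexConj L) 2 g) ∂νG)
    (k : ℕ) :
    ∃ c₁ : ℝ≥0, 0 < c₁ ∧ ∀ (c₀ : ℝ≥0) (hc : 0 < c₀), c₀ < c₁ → ∃ κ : ℝ≥0, 0 < κ ∧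
      ∀ u : HX (↥(maximalRealSubfield L)) L (IsCMField.complexConj L) 2 k μ, (κ : ℝ) * ‖u‖ ≤ ‖iota (iotaBound_cm L μ νG hβ hμZ hc k) u‖ := by
  obtain ⟨c₁, hc₁, hlow⟩ := exists_pos_forall_mul_eLpNorm_le_eLpNorm_comp_pZX_cm L μ νG hβ hμZ k
  refine ⟨c₁, hc₁, fun c₀ hc hlt => ?_⟩
  obtain ⟨κ, hκ, hκu⟩ := hlow c₀ hc hlt
  refine ⟨κ, hκ, fun u => ?_⟩
  have hiota : eLpNorm (iota (iotaBound_cm L μ νG hβ hμZ hc k) u : borelQuotient (↥(maximalRealSubfield L)) L (IsCMField.complexConj L) 2 → ℂ) 2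
        (weightedTruncMeasure (↥(maximalRealSubfield L)) L (IsCMField.complexConj L) 2 k c₀ μZ) =
      eLpNorm (fun z => (u : (quasiSplit (↥(maximalRealSubfield L)) L (IsCMField.complexConj L) 2).automorphicQuotient → ℂ)
        (pZX (↥(maximalRealSubfield L)) L (IsCMField.complexConj L) 2 z)) 2 (weightedTruncMeasure (↥(maximalRealSubfield L)) L (IsCMField.complexConj L) 2 k c₀ μZ) :=
    eLpNorm_congr_ae (coeFn_iota _ u)
  rw [Lp.norm_def, Lp.norm_def, ← ENNReal.coe_toReal κ, ← ENNReal.toReal_mul]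
  refine ENNReal.toReal_mono (Lp.eLpNorm_ne_top _) ?_
  rw [hiota]
  exact hκu u

/-- **THE CLOSED-EMBEDDING PACKAGE** (for `0 < c < c₁`): `ι_{c,k}` is antilipschitz, hence INJECTIVE with CLOSED RANGE — the `(hinj)(hcl)` letters of ★ leaf 2's `piN` (Mathlib
`ContinuousLinearMap.antilipschitz_of_bound`, `AntilipschitzWith.isClosed_range`; `𝓗_k(𝔛) = Lp` is complete). [cite: BernsteinLapid2019, §4 Claim 4 (p. 10)] -/
theorem exists_pos_iota_closedEmbedding_cm
    (μ : Measure (quasiSplit (↥(maximalRealSubfield L)) L (IsCMField.complexConj L) 2).automorphicQuotient)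
    [(quasiSplit (↥(maximalRealSubfield L)) L (IsCMField.complexConj L) 2).IsAutomorphicMeasure μ]
    (νG : Measure (quasiSplit (↥(maximalRealSubfield L)) L (IsCMField.complexConj L) 2).Adelic) [νG.IsHaarMeasure] [νG.IsInvInvariant]
    {β : (quasiSplit (↥(maximalRealSubfield L)) L (IsCMField.complexConj L) 2).Adelic → ℝ≥0∞}
    (hβ : IsCoveringWeight ↥((arithmeticBorel (↥(maximalRealSubfield L)) L (IsCMField.complexConj L) 2).map
      (quasiSplit (↥(maximalRealSubfield L)) L (IsCMField.complexConj L) 2).arithmeticSubgroup.subtype) β)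
    {μZ : Measure (borelQuotient (↥(maximalRealSubfield L)) L (IsCMField.complexConj L) 2)}
    (hμZ : ∀ f : borelQuotient (↥(maximalRealSubfield L)) L (IsCMField.complexConj L) 2 → ℝ≥0∞, Measurable f →
      ∫⁻ z, f z ∂μZ = ∫⁻ g, β g * f (toBorelQuotient (↥(maximalRealSubfield L)) L (IsCMField.complexConj L) 2 g) ∂νG)
    (k : ℕ) :
    ∃ c₁ : ℝ≥0, 0 < c₁ ∧ ∀ (c₀ : ℝ≥0) (hc : 0 < c₀), c₀ < c₁ →
      (∃ K : ℝ≥0, AntilipschitzWith K (iota (iotaBound_cm L μ νG hβ hμZ hc k))) ∧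
      Function.Injective (iota (iotaBound_cm L μ νG hβ hμZ hc k)) ∧
      IsClosed ((LinearMap.range (iota (iotaBound_cm L μ νG hβ hμZ hc k)).toLinearMap :
        Submodule ℂ (HN (↥(maximalRealSubfield L)) L (IsCMField.complexConj L) 2 k c₀ μZ)) :
          Set (HN (↥(maximalRealSubfield L)) L (IsCMField.complexConj L) 2 k c₀ μZ)) := by
  obtain ⟨c₁, hc₁, hlow⟩ := exists_pos_forall_mul_norm_le_norm_iota_cm L μ νG hβ hμZ k
  refine ⟨c₁, hc₁, fun c₀ hc hlt => ?_⟩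
  obtain ⟨κ, hκ, hκu⟩ := hlow c₀ hc hlt
  have hanti : AntilipschitzWith κ⁻¹ (iota (iotaBound_cm L μ νG hβ hμZ hc k)) := by
    refine ContinuousLinearMap.antilipschitz_of_bound _ fun u => ?_
    have h := hκu u
    have hκr : (0 : ℝ) < κ := NNReal.coe_pos.2 hκ
    rw [NNReal.coe_inv, ← div_eq_inv_mul, le_div_iff₀ hκr, mul_comm]
    exact h
  refine ⟨⟨κ⁻¹, hanti⟩, hanti.injective, ?_⟩
  rw [LinearMap.coe_range]
  exact hanti.isClosed_range (iota (iotaBound_cm L μ νG hβ hμZ hc k)).uniformContinuous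

/-! ## §2 `𝓗_k(Z_c)` has finite total mass -/

/-- **`wtm_{k,c} μZ` IS A FINITE MEASURE** (every `c > 0`): `wtm(Z) = ∫⁻_Z 𝟙 ∘ p d(wtm) ≤ B · ∫⁻_𝔛 w₁^{−2k} dμ ≤ B · c₁^{−2k} · μ(𝔛) < ∞` — ★ part 2 upper comparison at `F ≡ 1`,
`w₁ > c₁ > 0` everywhere by the ★ covering `exists_pos_forall_lt_ciSup_borelHeight_mul_cm` (so `w₁^{−2k} ≤ c₁^{−2k}`), and `μ(𝔛) < ∞` (`IsAutomorphicMeasure`).  The `[IsFiniteMeasure (wtm k c₀ μZ)]`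
argument of ★ `K2E1TruncatedCuspCompactU2` (K2E4-p23) is thereby paid. [cite: BernsteinLapid2019, §4 Claim 5 (p. 10)] [cite: MoeglinWaldspurger1995, I.2.13] -/
theorem isFiniteMeasure_weightedTruncMeasure_cm
    (μ : Measure (quasiSplit (↥(maximalRealSubfield L)) L (IsCMField.complexConj L) 2).automorphicQuotient)
    [(quasiSplit (↥(maximalRealSubfield L)) L (IsCMField.complexConj L) 2).IsAutomorphicMeasure μ]
    (νG : Measure (quasiSplit (↥(maximalRealSubfield L)) L (IsCMField.complexConj L) 2).Adelic) [νG.IsHaarMeasure] [νG.IsInvInvariant]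
    {β : (quasiSplit (↥(maximalRealSubfield L)) L (IsCMField.complexConj L) 2).Adelic → ℝ≥0∞}
    (hβ : IsCoveringWeight ↥((arithmeticBorel (↥(maximalRealSubfield L)) L (IsCMField.complexConj L) 2).map
      (quasiSplit (↥(maximalRealSubfield L)) L (IsCMField.complexConj L) 2).arithmeticSubgroup.subtype) β)
    {μZ : Measure (borelQuotient (↥(maximalRealSubfield L)) L (IsCMField.complexConj L) 2)}
    (hμZ : ∀ f : borelQuotient (↥(maximalRealSubfield L)) L (IsCMField.complexConj L) 2 → ℝ≥0∞, Measurable f →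
      ∫⁻ z, f z ∂μZ = ∫⁻ g, β g * f (toBorelQuotient (↥(maximalRealSubfield L)) L (IsCMField.complexConj L) 2 g) ∂νG)
    {c₀ : ℝ≥0} (hc : 0 < c₀) (k : ℕ) :
    IsFiniteMeasure (weightedTruncMeasure (↥(maximalRealSubfield L)) L (IsCMField.complexConj L) 2 k c₀ μZ) := by
  obtain ⟨B, hBt, hB⟩ := exists_forall_lintegral_comp_pZX_le_cm L μ νG hβ hμZ hc k
  obtain ⟨c₁, hc₁, hcov⟩ := exists_pos_forall_lt_ciSup_borelHeight_mul_cm L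
  refine ⟨?_⟩
  have h1 := hB (fun _ => 1) measurable_const
  simp only [lintegral_const, one_mul] at h1
  -- `w₁^{−2k} ≤ c₁^{−2k}` pointwise
  have hw : ∀ x : (quasiSplit (↥(maximalRealSubfield L)) L (IsCMField.complexConj L) 2).automorphicQuotient,
      (((supHeight (↥(maximalRealSubfield L)) L (IsCMField.complexConj L) 2 x)⁻¹ ^ (2 * k) : ℝ≥0) : ℝ≥0∞) ≤ ((c₁⁻¹ ^ (2 * k) : ℝ≥0) : ℝ≥0∞) := by
    intro x
    have hx : c₁ < supHeight (↥(maximalRealSubfield L)) L (IsCMField.complexConj L) 2 x := by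
      rw [supHeight_eq_ciSup]; exact hcov _
    gcongr
  have h2 : ∫⁻ x, (((supHeight (↥(maximalRealSubfield L)) L (IsCMField.complexConj L) 2 x)⁻¹ ^ (2 * k) : ℝ≥0) : ℝ≥0∞) ∂μ ≤ ((c₁⁻¹ ^ (2 * k) : ℝ≥0) : ℝ≥0∞) * μ Set.univ := by
    calc _ ≤ ∫⁻ _x, ((c₁⁻¹ ^ (2 * k) : ℝ≥0) : ℝ≥0∞) ∂μ := lintegral_mono hw
      _ = _ := lintegral_const _
  calc weightedTruncMeasure (↥(maximalRealSubfield L)) L (IsCMField.complexConj L) 2 k c₀ μZ Set.univ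
      ≤ B * ∫⁻ x, (((supHeight (↥(maximalRealSubfield L)) L (IsCMField.complexConj L) 2 x)⁻¹ ^ (2 * k) : ℝ≥0) : ℝ≥0∞) ∂μ := h1
    _ ≤ B * (((c₁⁻¹ ^ (2 * k) : ℝ≥0) : ℝ≥0∞) * μ Set.univ) := by gcongr
    _ < ⊤ := ENNReal.mul_lt_top hBt.lt_top (ENNReal.mul_lt_top ENNReal.coe_lt_top (measure_lt_top μ _))

end Summit.HodgeConjecture.HodgeConjecture.Cruxes.H413.K2E1BLIotaClosedEmbeddingU2

end
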